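import Literature.NumberTheory.EllipticCurves.Rank1Residual.Typed.X5DescentAnyLevel
import HarnessLib

/-!
# X5 (p = 2): the ONE-ITEM input is NECESSARY as well — the item is exactly the datum

Support file for the BSD rank-≤ 1 residual programme, class X5 (`p = 2`), unit `b2b-bsdres-sha-1`
(gen 6). Honest framing: prove what is provable now; shrink each hard class to its core with data;
no claim beyond stated classes. Everything here is proved; nothing is claimed for any curve.

`X5DescentAnyLevel` shows that ONE pairing bit at level `(2^(k+1), 2)` — equivalently ONE
`2^(k+1)`-Selmer class outside `[2]_* Sel^(2^(k+2))` — GIVES the stabilisation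
`Ш[2^(k+2)] = Ш[2^(k+1)]` when `#Ш[2] = 4` and `Ш[2^k] ⊆ 2Ш`. This file proves the CONVERSE, so
that the typed OPEN input of the lower-bound-only rows (19074h1/h2: `hs` of
`X5.bsdp_two_of_selmer_item₈`, `hbit` of `X5.bsdp_two_of_pairing_bit₈`) is not a convenient
sufficient condition but is EQUIVALENT to the missing datum — nothing weaker can be asked of any
descent engine:

* `exists_exact_order_two_pow` — `#A[2] = 4` (indeed `A[2] ≠ 0`) and `A[2^k] ⊆ 2A` give an element
  of exact order `2^(k+1)` (halve `k` times);
* `exists_not_two_divisible_of_stable` — stabilisation `A[2^(k+2)] = A[2^(k+1)]` and an element of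
  exact order `2^(k+1)` give an element of `A[2^(k+1)]` that is NOT twice an element;
* `exists_pairing_bit_of_stable` — hence, for any `B` with the orthogonality property (Cassels–Tate
  kernel), a pairing bit at level `(2^(k+1), 2)`; `stable_two_pow_iff_pairing_bit` — the iff;
* `X5.exists_not_mem_selmer_of_stable_level` — over the tree's Selmer groups: `#Ш[2] = 4`, every
  `2^k`-Selmer class lifts, and `Ш[2^(k+2)] = Ш[2^(k+1)]` ⟹ SOME `s ∈ Sel^(2^(k+1))(E/ℚ)` is outside
  `[2]_* Sel^(2^(k+2))(E/ℚ)`; with `X5DescentAnyLevel` this is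
  `X5.stable_level_iff_exists_selmer_item` (granted bsd.S18 on a finite `Ш` for `⇐`).

References: Silverman, *AEC* (2009), Thm. X.4.2, Thm. X.4.14; Cassels (1962), Arithmetic IV,
Thm. 1.1; Cassels (1998), §1; Stamminger (2005), Thm. 6.2.2.
-/

noncomputable section

open scoped Classical
open scoped AddSubgroup

open WeierstrassCurve Literature.NumberTheory.EllipticCurves
  Literature.NumberTheory.EllipticCurves.Rank1Residual
  Literature.GroupTheory.FiniteAbelian

namespace Literature.NumberTheory.EllipticCurves.Rank1Residual.Typed

/-! ### §1 Algebra -/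

section Algebra

variable {A : Type*} [AddCommGroup A] {Q : Type*} [AddCommGroup Q] (B : A →+ A →+ Q)

omit B in
/-- `2^(j+1) • v = 2^j • (2 • v)` (content-free private helper). [folklore] -/
private theorem two_pow_succ_smul₉ (j : ℕ) (v : A) : 2 ^ (j + 1) • v = 2 ^ j • (2 • v) := by
  rw [smul_smul, pow_succ]

omit B in
/-- **An element of exact order `2^(k+1)`** from `#A[2] = 4` and `A[2^k] ⊆ 2A`: a non-zero
`2`-torsion element, halved `k` times (`A[2^j] ⊆ A[2^k] ⊆ 2A` for `j ≤ k`).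
[cite: SilvermanAEC2009, Thm. X.4.2(a)] [cite: MerrimanSiksekSmart1996, §4] -/
theorem exists_exact_order_two_pow {k : ℕ} (hcard : Nat.card (A[(2 : ℕ)]) = 4)
    (hdiv : ∀ y : A, 2 ^ k • y = 0 → ∃ x : A, 2 • x = y) :
    ∃ x : A, 2 ^ (k + 1) • x = 0 ∧ 2 ^ k • x ≠ 0 := by
  induction k with
  | zero =>
    -- a non-zero element of the four-element `A[2]`
    by_contra h
    have hbot : A[(2 : ℕ)] = ⊥ := by
      rw [eq_bot_iff]
      intro y hy
      rw [AddSubgroup.mem_bot]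
      have hy2 : 2 • y = 0 := AddSubgroup.torsionBy.nsmul_iff.1 hy
      by_contra hy0
      exact h ⟨y, by simpa using hy2, by simpa using hy0⟩
    rw [hbot, AddSubgroup.card_bot] at hcard
    exact absurd hcard (by norm_num)
  | succ k ih =>
    have hdiv' : ∀ y : A, 2 ^ k • y = 0 → ∃ x : A, 2 • x = y := fun y hy =>
      hdiv y (by rw [two_pow_succ_smul₉, smul_comm, hy, smul_zero])
    obtain ⟨x, hx1, hx0⟩ := ih hdiv'
    obtain ⟨w, rfl⟩ := hdiv x hx1
    refine ⟨w, ?_, ?_⟩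
    · rw [two_pow_succ_smul₉]; exact hx1
    · rw [two_pow_succ_smul₉]; exact hx0

omit B in
/-- **Stabilisation forces a non-divisible element**: if `A[2^(k+2)] = A[2^(k+1)]` and `x` has exact
order `2^(k+1)`, then `x` is NOT twice an element (a half `w` of `x` would lie in
`A[2^(k+2)] = A[2^(k+1)]`, so `2^k x = 2^(k+1) w = 0`). [cite: SilvermanAEC2009, Thm. X.4.14] [cite: Cassels1998, §1] -/
theorem exists_not_two_divisible_of_stable {k : ℕ}
    (hstab : ∀ z : A, 2 ^ (k + 2) • z = 0 → 2 ^ (k + 1) • z = 0)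
    (hx : ∃ x : A, 2 ^ (k + 1) • x = 0 ∧ 2 ^ k • x ≠ 0) :
    ∃ x : A, 2 ^ (k + 1) • x = 0 ∧ ¬ ∃ w : A, 2 • w = x := by
  obtain ⟨x, hx1, hx0⟩ := hx
  refine ⟨x, hx1, ?_⟩
  rintro ⟨w, rfl⟩
  apply hx0
  have h2 : 2 ^ (k + 2) • w = 0 := by rw [two_pow_succ_smul₉]; exact hx1
  rw [← two_pow_succ_smul₉]
  exact hstab w h2

/-- **The pairing bit is NECESSARY**: with the orthogonality property (`horth`, the Cassels–Tate
kernel property on a finite `Ш`), stabilisation `A[2^(k+2)] = A[2^(k+1)]` and an element of exact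
order `2^(k+1)` give `x ∈ A[2^(k+1)]`, `y ∈ A[2]` with `B x y ≠ 0`.
[cite: SilvermanAEC2009, Thm. X.4.14] [cite: Cassels1962ArithmeticIV, Thm. 1.1] -/
theorem exists_pairing_bit_of_stable {k : ℕ}
    (horth : ∀ x : A, (∀ y : A, 2 • y = 0 → B x y = 0) → ∃ w : A, 2 • w = x)
    (hstab : ∀ z : A, 2 ^ (k + 2) • z = 0 → 2 ^ (k + 1) • z = 0)
    (hx : ∃ x : A, 2 ^ (k + 1) • x = 0 ∧ 2 ^ k • x ≠ 0) :
    ∃ x y : A, 2 ^ (k + 1) • x = 0 ∧ 2 • y = 0 ∧ B x y ≠ 0 := by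
  obtain ⟨x, hx1, hx2⟩ := exists_not_two_divisible_of_stable hstab hx
  by_contra h
  exact hx2 (horth x fun y hy => Classical.by_contradiction fun hB => h ⟨x, y, hx1, hy, hB⟩)

/-- **THE ITEM IS EXACTLY THE DATUM (abstract form).** For an alternating bi-additive `B` with the
orthogonality property on `A` with `#A[2] = 4` and `A[2^k] ⊆ 2A`:
`A[2^(k+2)] = A[2^(k+1)]` **iff** ONE pair `x ∈ A[2^(k+1)]`, `y ∈ A[2]` has `B x y ≠ 0`.
[cite: SilvermanAEC2009, Thm. X.4.14] [cite: Cassels1962ArithmeticIV, Thm. 1.1] [cite: Cassels1998, §1] -/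
theorem stable_two_pow_iff_pairing_bit {k : ℕ} (halt : ∀ x : A, B x x = 0)
    (horth : ∀ x : A, (∀ y : A, 2 • y = 0 → B x y = 0) → ∃ w : A, 2 • w = x)
    (hcard : Nat.card (A[(2 : ℕ)]) = 4) (hdiv : ∀ y : A, 2 ^ k • y = 0 → ∃ x : A, 2 • x = y) :
    (∀ z : A, 2 ^ (k + 2) • z = 0 → 2 ^ (k + 1) • z = 0) ↔
      ∃ x y : A, 2 ^ (k + 1) • x = 0 ∧ 2 • y = 0 ∧ B x y ≠ 0 :=
  ⟨fun hstab => exists_pairing_bit_of_stable B horth hstab (exists_exact_order_two_pow hcard hdiv),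
    fun hbit => stable_two_pow_of_pairing_bit B halt hcard hdiv hbit⟩

end Algebra

/-! ### §2 Over the tree's Selmer groups -/

section Sha

variable (W : WeierstrassCurve ℚ) [W.IsElliptic] [W.IsGloballyMinimal]

omit [W.IsElliptic] [W.IsGloballyMinimal] in
/-- **The Selmer item is NECESSARY**: `#Ш[2] = 4`, every `2^k`-Selmer class lifts to `Sel^(2^(k+1))`
(`Ш[2^k] ⊆ 2Ш`), and `Ш[2^(k+2)] = Ш[2^(k+1)]` ⟹ SOME `s ∈ Sel^(2^(k+1))(E/ℚ)` lies outside
`[2]_* Sel^(2^(k+2))(E/ℚ)` (take `s` above a non-divisible `x ∈ Ш[2^(k+1)]`; `[2]_* z ↦ 2·π(z)`).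
So on a lower-bound-only row the OPEN input `hs` of `X5.bsdp_two_of_selmer_item_level` is
equivalent to the missing datum. Nothing is claimed for any curve.
[cite: SilvermanAEC2009, Thm. X.4.2(a), Thm. X.4.14] [cite: Stamminger2005, Thm. 6.2.2] -/
theorem X5.exists_not_mem_selmer_of_stable_level {k : ℕ}
    (h2 : Nat.card (AddSubgroup.torsionBy W.sha 2) = 4)
    (hF : ∀ s : W.selmerGroup (2 ^ k : ℕ), ∃ z : W.selmerGroup (2 ^ (k + 1) : ℕ),
      W.selmerZSMul 2 (two_pow_succ_dvd_mul_two k) z = s)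
    (hstab : ∀ z : W.sha, 2 ^ (k + 2) • z = 0 → 2 ^ (k + 1) • z = 0) :
    ∃ s : W.selmerGroup (2 ^ (k + 1) : ℕ), ¬ ∃ z : W.selmerGroup (2 ^ (k + 2) : ℕ),
      W.selmerZSMul 2 (two_pow_succ_dvd_mul_two (k + 1)) z = s := by
  have hdiv := X5.two_divisible_of_selmer_lift_level W hF
  obtain ⟨x, hx1, hx2⟩ :=
    exists_not_two_divisible_of_stable hstab (exists_exact_order_two_pow (by simpa using h2) hdiv)
  obtain ⟨s, rfl⟩ := W.exists_selmerToSha_eq (n := ((2 ^ (k + 1) : ℕ) : ℤ)) (by positivity) x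
    (by rw [Nat.cast_smul_eq_nsmul]; exact hx1)
  refine ⟨s, ?_⟩
  rintro ⟨z, rfl⟩
  exact hx2 ⟨W.selmerToSha _ z, by rw [selmerToSha_selmerZSMul, ofNat_zsmul]⟩

omit [W.IsGloballyMinimal] in
/-- **THE ITEM IS EXACTLY THE DATUM (Selmer form).** Granted the Cassels–Tate pairing (bsd.S18,
`hCT`) on a finite `Ш(E/ℚ)`: for a curve with `#Ш[2] = 4` whose `2^k`-Selmer classes all lift one
level, `Ш[2^(k+2)] = Ш[2^(k+1)]` **iff** SOME `s ∈ Sel^(2^(k+1))(E/ℚ)` lies outside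
`[2]_* Sel^(2^(k+2))(E/ℚ)`. (`⇐` is `X5DescentAnyLevel`; `⇒` is the lemma above.) Nothing is
claimed for any curve. [cite: SilvermanAEC2009, Thm. X.4.2(a), Thm. X.4.14] [cite: Cassels1962ArithmeticIV, Thm. 1.1] [cite: Stamminger2005, Thm. 6.2.2] -/
theorem X5.stable_level_iff_exists_selmer_item {k : ℕ} [Finite W.sha]
    (hCT : WeierstrassCurve.exists_casselsTate_pairing (K := ℚ))
    (h2 : Nat.card (AddSubgroup.torsionBy W.sha 2) = 4)
    (hF : ∀ s : W.selmerGroup (2 ^ k : ℕ), ∃ z : W.selmerGroup (2 ^ (k + 1) : ℕ),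
      W.selmerZSMul 2 (two_pow_succ_dvd_mul_two k) z = s) :
    (∀ z : W.sha, 2 ^ (k + 2) • z = 0 → 2 ^ (k + 1) • z = 0) ↔
      ∃ s : W.selmerGroup (2 ^ (k + 1) : ℕ), ¬ ∃ z : W.selmerGroup (2 ^ (k + 2) : ℕ),
        W.selmerZSMul 2 (two_pow_succ_dvd_mul_two (k + 1)) z = s := by
  refine ⟨X5.exists_not_mem_selmer_of_stable_level W h2 hF, ?_⟩
  rintro ⟨s, hs⟩
  obtain ⟨B, halt, horth⟩ := sha_orthogonal_two_of_casselsTate W hCT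
  have hS : 2 ^ (k + 1) • W.selmerToSha _ s = 0 := by
    have h := W.zsmul_selmerToSha ((2 ^ (k + 1) : ℕ) : ℤ) s
    rwa [Nat.cast_smul_eq_nsmul] at h
  exact stable_two_pow_of_witness B halt horth (by simpa using h2)
    (X5.two_divisible_of_selmer_lift_level W hF)
    ⟨_, hS, X5.not_two_divisible_of_not_mem_selmer_level W hs⟩

end Sha

end Literature.NumberTheory.EllipticCurves.Rank1Residual.Typed

end
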